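import Summits.Ventures.Crystal3D.Theorems.StickyWulffConstantGenericWallFloorExactOnly
import HarnessLib

/-!
# `ExactOnly` from an inside-tube uniqueness and an outside-tube exhaustion (format-agnostic E1 glue;
# crux `GenericWallFloor`, line `WallLedgerG`)

HONEST FRAMING. Part of the venture `Summits/Ventures/Crystal3D` (cell `crystal3d-full`), helper
`--supports` the crux `GenericWallFloor` (stmt-Ventures-19480), registered line `WallLedgerG`, open stub
`stub_twoSlabAdhesion`.  The E1 certification of a row («own pattern `O` is exact-only») has two halves:
INSIDE the tube around each special completion the kissing completion is unique (kernel: `eq_of_coneMargin`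
…TubeLemma, `ConeCert.*` …ConeCertificate*, lit g11 / 19480-p2), and OUTSIDE the tubes there is nothing
(branch-and-bound exhaustion, eng lineage B / cf-p2 R38 — certified computation).  This file is the
two-line glue turning the pair into the E2 predicate `ExactOnly 0 O` of `…GenericWallFloorExactOnly`, with
the matching stated via `Literature…KissingPatterns.EtaMatched`:
`exactOnly_of_tube_and_exhaustion` (special completions as free parts `S`, `IsClosePackedDozenAt 0 (O ∪ S)`)
and `exactOnly_of_tube_and_exhaustion'` (special completions as full dozens `D ⊇ O`).

WHAT THIS IS NOT: neither half is proved here; rung F-C1 not moved.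
-/

noncomputable section

namespace Summit.Ventures.Crystal3D.Theorems

open Finset Literature.Geometry.DiscreteGeometry

/-- **E1 glue: `ExactOnly` from the two halves of a certification row.**  Let `O` be an own pattern
around the origin and `specs` a finite list of «special completions» `S` (each making `O ∪ S` a
close-packed dozen).  If (inside tube) every twelve-point kissing completion `N ⊇ O` whose free part
`N \\ O` is `r`-matched to some `S ∈ specs` has free part EQUAL to `S`, and (outside tube / exhaustion) every
kissing completion's free part is `r`-matched to SOME `S ∈ specs`, then `O` is exact-only.  The first
hypothesis is what the cone certificates deliver (`eq_of_coneMargin` / `ConeCert.eq_slots`), the second is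
the branch-and-bound exhaustion (certified computation). -/
theorem exactOnly_of_tube_and_exhaustion (O : Finset (EuclideanSpace ℝ (Fin 3)))
    (specs : Finset (Finset (EuclideanSpace ℝ (Fin 3)))) (r : ℝ)
    (hspec : ∀ S ∈ specs, IsClosePackedDozenAt 0 (O ∪ S))
    (htube : ∀ S ∈ specs, ∀ N : Finset (EuclideanSpace ℝ (Fin 3)), O ⊆ N → N.card = 12 →
      IsKissingAround 0 N → EtaMatched r (N \ O) S → N \ O = S)
    (hexh : ∀ N : Finset (EuclideanSpace ℝ (Fin 3)), O ⊆ N → N.card = 12 → IsKissingAround 0 N →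
      ∃ S ∈ specs, EtaMatched r (N \ O) S) :
    ExactOnly 0 O := by
  classical
  intro N hON hcard hkiss
  obtain ⟨S, hS, hmatch⟩ := hexh N hON hcard hkiss
  have hfree : N \ O = S := htube S hS N hON hcard hkiss hmatch
  have hN : N = O ∪ S := by rw [← hfree, Finset.union_sdiff_of_subset hON]
  rw [hN]
  exact hspec S hS

/-- The same with the special completions given as full dozens `D ⊇ O` (free part `D \\ O`). -/
theorem exactOnly_of_tube_and_exhaustion' (O : Finset (EuclideanSpace ℝ (Fin 3)))
    (dozens : Finset (Finset (EuclideanSpace ℝ (Fin 3)))) (r : ℝ)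
    (hsub : ∀ D ∈ dozens, O ⊆ D) (hcp : ∀ D ∈ dozens, IsClosePackedDozenAt 0 D)
    (htube : ∀ D ∈ dozens, ∀ N : Finset (EuclideanSpace ℝ (Fin 3)), O ⊆ N → N.card = 12 →
      IsKissingAround 0 N → EtaMatched r (N \ O) (D \ O) → N \ O = D \ O)
    (hexh : ∀ N : Finset (EuclideanSpace ℝ (Fin 3)), O ⊆ N → N.card = 12 → IsKissingAround 0 N →
      ∃ D ∈ dozens, EtaMatched r (N \ O) (D \ O)) :
    ExactOnly 0 O := by
  classical
  intro N hON hcard hkiss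
  obtain ⟨D, hD, hmatch⟩ := hexh N hON hcard hkiss
  have hfree : N \ O = D \ O := htube D hD N hON hcard hkiss hmatch
  have hN : N = D := by
    rw [← Finset.union_sdiff_of_subset hON, hfree, Finset.union_sdiff_of_subset (hsub D hD)]
  rw [hN]
  exact hcp D hD

end Summit.Ventures.Crystal3D.Theorems

end
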